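import Literature.NumberTheory.Automorphic.HarrisLanTaylorThorneThm713
import HarnessLib

/-!
# Harris–Lan–Taylor–Thorne 2016, Thm. 7.13 with both alternatives on `q` — the proof

Topic `Literature/NumberTheory/Automorphic`; sibling proofs file of
`HarrisLanTaylorThorneThm713` (whose vocabulary and infrastructure it uses: `GammaS`,
`FramedGaloisRep.descend`, `FramedRep.inflate`, `muS`, `GammaS.dense_frob`, `twistedSum_unique`,
`finite_setOf_not_exists_goodPrime`) and of `HarrisLanTaylorThorneCor627` (the named facts
`corollary627_unramified`, `corollary627_splitOrUnramified`, the predicates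
`HasSplitImaginaryQuadraticSubfield`, `HasTwoPrimesOver`).

M. Harris, K.-W. Lan, R. Taylor, J. Thorne, *On the rigid cohomology of certain Shimura
varieties*, Res. Math. Sci. 3:37 (2016), Thm. 7.13 (p. 232), in the standing notation of the
paper (p. 11: `F = F₀F⁺` a CM field containing an imaginary quadratic field `F₀` in which `p`
splits): "Suppose that `π` is a cuspidal automorphic representation of `GL_n(𝔸_F)` such that
`π_∞` has the same infinitesimal character as an algebraic representation of `RS^F_ℚ GL_n`. Then
there is a continuous semi-simple representation `r_{p,ı}(π) : G_F → GL_n(ℚ̄_p)` with the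
following property: Suppose that `q ≠ p` is a rational prime which **either splits in `F₀` or
is unramified in `F`**. Suppose further that `π` is unramified at all primes of `F` above `q`.
If `v | q` is a prime of `F`, then
`r_{p,ı}(π)|^{F-ss}_{W_{F_v}} = ı⁻¹ rec_{F_v}(π_v |det|_v^{(1-n)/2})`."

`HarrisLanTaylorThorneThm713` proves this (for `n > 1`, following the printed proof via
Prop. 7.12) in the branch "`q` unramified in `F`" only, because the form of Cor. 6.27 it
consumes (`corollary627_unramified`) keeps only that alternative.  This file

* isolates the group-theoretic engine of the printed proof as `theorem713_of_goodPlaces`: for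
  **any** finite set `S` of finite places of `K` away from which `p` does not lie below, `π` is
  unramified, and a family `R_N` (`N ≥ N₀`) of continuous semisimple `2n`-dimensional
  representations has the Frobenius characteristic polynomials
  `arithFrobPolyOfSatake ı q_v n α_v · ∏_{b ∈ B_v}(X - b q_v^{-2N})` (the output shape of
  Cor. 6.27), there is a continuous semisimple `n`-dimensional `r`, unramified outside `S`, whose
  arithmetic Frobenii at `v ∉ S` have characteristic polynomial `arithFrobPolyOfSatake ı q_v n α_v`
  — Prop. 7.12 applied to `Γ = Γ_{K,S}`, `μ = ε_p^{-2}`, `𝔉` = Frobenii outside `S`,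
  `ℳ = [N₀, ∞)`, exactly as on p. 232 (the proof is the one of
  `theorem713_unramified_of`, whose set of good places was hard-wired);
* deduces **Thm. 7.13 with both printed alternatives** for `n > 1`, `theorem713_of`, from the
  named fact `corollary627_splitOrUnramified` (HLTT Cor. 6.27 with both alternatives, for a
  fixed imaginary quadratic `F₀ ⊆ K` in which `p` splits) together with `prop712Hausdorff`,
  `chebotarev_artinRep` (through `frobenius_dense`), `hasSatakeParamAt_ne_zero` and Flath's
  `hasSatakeParamAt_cofinite` (hypothesis), the good places now being those over a rational
  prime `q ≠ p` with (`q` split in `F₀` or unramified in `K`) and `π` unramified above `q`;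
* records that the two-alternative theorem specialises to the statement of
  `theorem713_unramified_of` (`theorem713_unramified_of_splitOrUnramified`); that statement is
  also the case `Q q := (q unramified in K)` of `exists_isGaloisCompatibleAt_of_goodPrime` with
  the data of `corollary627_unramified` (the tree's proof of it, written before the engine was
  isolated, could be replaced by that one-line specialisation).

On the set `S`.  The printed proof takes "`S` = the set of rational primes above which `F` or
`π` ramifies together with `p`" and `𝔉` = Frobenii at primes not above `S`; with this `S` a
prime `v | q` with `q` split in `F₀` but ramified in `F` lies above `S`, and the conclusion at
such `v` is not reached by the density argument as written.  The argument goes through verbatim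
with the smaller exceptional set actually used here — the places not over a good rational prime
(for the two-alternative theorem: `p`, the rational primes that are both non-split in `F₀` and
ramified in `F`, and those below a ramified place of `π`; cf. the set `S` of HLTT p. 196,
"containing `p` and all rational primes `q` which are both non-split in `F₀` and ramified in
`F`") — since all that is needed of `S` is that it be finite and that the `R_N` be unramified
with the displayed Frobenius characteristic polynomials outside it.  The case `n = 1` ("well
known": class field theory) and Cor. 7.14 (patching, base change) remain out of scope, as in
`HarrisLanTaylorThorneThm713`.

## References

* M. Harris, K.-W. Lan, R. Taylor, J. Thorne, *On the rigid cohomology of certain Shimura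
  varieties*, Res. Math. Sci. 3:37 (2016): p. 11 (notation), p. 196 (the set `S`), Cor. 6.27
  (p. 225), Cor. 7.3 (pp. 227–228), Prop. 7.12, Thm. 7.13 and its proof (p. 232).
  [HarrisLanTaylorThorneRMS2016]
* D. Flath, *Decomposition of representations into tensor products*, Corvallis (1979), Thm. 3.
  [Flath1979]
-/

noncomputable section

open scoped MatrixGroups Matrix Classical Polynomial NumberField
open NumberField IsDedekindDomain Field Polynomial Literature.NumberTheory.Automorphic

namespace Literature.NumberTheory.Automorphic.HarrisLanTaylorThorne2016

/-! ### The engine: Prop. 7.12 applied to `Γ_{K,S}`, `μ = ε_p^{-2}`, Frobenii outside `S` -/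

/-- **The group-theoretic engine of the proof of HLTT Thm. 7.13** (p. 232).  Let `K` be a number
field, `p` a prime, `n > 0`, `π` an automorphic representation of `GL_n(𝔸_K)`, `ı : ℚ̄_p ≃ ℂ`,
and `S` a **finite** set of finite places of `K` such that every `v ∉ S` satisfies `v ∤ p` and
`π_v` is unramified.  Suppose given `N₀`, continuous `R_N : Γ_K → GL_{2n}(ℚ̄_p)`, semisimple for
`N ≥ N₀`, and for `v ∉ S` an `n`-element multiset `B_v ∌ 0` of `ℚ̄_p`, such that for `v ∉ S`,
`N ≥ N₀` and every Satake parameter `α` of `π_v`: `R_N` is unramified at `v` with arithmetic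
Frobenius characteristic polynomial
`arithFrobPolyOfSatake ı q_v n α · ∏_{b ∈ B_v} (X - b q_v^{-2N})` (the output of Cor. 6.27).  Then there is a continuous semisimple `r : Γ_K → GL_n(ℚ̄_p)`,
unramified outside `S`, all of whose arithmetic Frobenii at `v ∉ S` have characteristic
polynomial `arithFrobPolyOfSatake ı q_v n α`.  Proof = the printed proof of Thm. 7.13:
Prop. 7.12 (`prop712Hausdorff`) for `Γ = Γ_{K,S}` (`GammaS K S`), `k = ℚ̄_p`, `μ = ε_p^{-2}` (`muS`, of
infinite order `q_v^{-2}` on Frobenii), `𝔉` = the images of the arithmetic Frobenii outside `S`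
(dense: `GammaS.dense_frob`, from `chebotarev_artinRep`), `ℳ = [N₀, ∞)`, `ρ_m` = the descent of
`R_m`, `𝔈¹_f` = roots of `arithFrobPolyOfSatake` and `𝔈²_f = B_v` at a chosen Frobenius
representative of `f` (`0 ∉ 𝔈¹` by `hasSatakeParamAt_ne_zero`); the value at every Frobenius is
then pinned down by the uniqueness of twisted-sum decompositions (Cor. 7.3, `twistedSum_unique`)
and "monic, split, same roots".  (This is the proof of `theorem713_unramified_of` with its set of
good places made a parameter.)
[cite: HarrisLanTaylorThorneRMS2016, proof of Thm. 7.13 (p. 232)] -/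
theorem theorem713_of_goodPlaces (h712 : Literature.NumberTheory.GaloisRepresentations.HarrisLanTaylorThorne2016.prop712Hausdorff)
    (hC : Automorphic.chebotarev_artinRep) (hne : hasSatakeParamAt_ne_zero)
    {n : ℕ} {K : Type} [Field K] [NumberField K] {hcpt : isCompact_glFiniteIntegralLevel n K}
    (p : ℕ) [Fact p.Prime] (hn : 0 < n) (π : AutomorphicRepData (AutomorphyDatum.gl n K hcpt))
    (ι : PadicAlgCl p ≃+* ℂ) {S : Set (HeightOneSpectrum (𝓞 K))} (hSfin : S.Finite)
    (hSp : ∀ v ∉ S, ((p : ℕ) : 𝓞 K) ∉ v.asIdeal)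
    (hSat : ∀ v ∉ S, ∃ α : Multiset ℂ, π.HasSatakeParamAt v α)
    {N₀ : ℕ} {R : ℕ → GaloisRepresentations.FramedGaloisRep K (PadicAlgCl p) (2 * n)}
    {B : HeightOneSpectrum (𝓞 K) → Multiset (PadicAlgCl p)}
    (hRss : ∀ N, N₀ ≤ N → (R N).toGaloisRep.IsSemisimple)
    (hB : ∀ v ∉ S, Multiset.card (B v) = n ∧ (0 : PadicAlgCl p) ∉ B v)
    (hRv : ∀ v ∉ S, ∀ N, N₀ ≤ N → (R N).IsUnramifiedAt v ∧
      ∀ α : Multiset ℂ, π.HasSatakeParamAt v α →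
        (R N).HasFrobCharpolyAt v (arithFrobPolyOfSatake ι v.residueCard n α *
          ((B v).map fun b ↦ X - C (b * ((v.residueCard : PadicAlgCl p)⁻¹) ^ (2 * N))).prod)) :
    ∃ r : GaloisRepresentations.FramedGaloisRep K (PadicAlgCl p) n, r.toGaloisRep.IsSemisimple ∧
      ∀ v ∉ S, r.IsUnramifiedAt v ∧ ∀ α : Multiset ℂ, π.HasSatakeParamAt v α →
        r.HasFrobCharpolyAt v (arithFrobPolyOfSatake ι v.residueCard n α) := by
  classical
  have hRunr : ∀ N, N₀ ≤ N → ∀ v ∉ S, (R N).IsUnramifiedAt v :=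
    fun N hN v hv ↦ (hRv v hv N hN).1
  -- `Γ = Γ_{K,S}`, the family `ρ_m`, the character `μ`, the dense set `𝔉`
  let ρ : ℤ → GaloisRepresentations.FramedRep (GammaS K S) (PadicAlgCl p) (2 * n) := fun m ↦
    if hm : (N₀ : ℤ) ≤ m then (R m.toNat).descend (hRunr m.toNat (by omega))
    else (R N₀).descend (hRunr N₀ le_rfl)
  have hρ_of_le : ∀ {m : ℤ} (hm : (N₀ : ℤ) ≤ m),
      ρ m = (R m.toNat).descend (hRunr m.toNat (by omega)) := fun hm ↦ dif_pos hm
  let μ : GammaS K S →ₜ* (PadicAlgCl p)ˣ := muS p S hSp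
  let 𝔉 : Set (GammaS K S) :=
    QuotientGroup.mk '' {σ | ∃ v ∉ S, ∃ 𝔓 ∈ v.primesAbove, IsArithFrobAt (𝓞 K) σ 𝔓}
  have h𝔉 : Dense 𝔉 := GammaS.dense_frob hC hSfin
  have hμord : ∀ f ∈ 𝔉, ¬ IsOfFinOrder (μ f) := by
    rintro _ ⟨σ, ⟨v, hv, 𝔓, h𝔓, hσ⟩, rfl⟩
    exact not_isOfFinOrder_muS_mk p S hSp hv h𝔓 hσ
  -- the root multisets `E₁ v α` = roots of `arithFrobPolyOfSatake ı q_v n α`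
  let E₁ : HeightOneSpectrum (𝓞 K) → Multiset ℂ → Multiset (PadicAlgCl p) := fun v α ↦
    (arithFrobPolyOfSatake ι v.residueCard n α).roots
  -- the key computation: the roots of `charpoly (ρ_m (Frob_v))` at a good place `v`
  have hcomp : ∀ {m : ℤ} (_ : (N₀ : ℤ) ≤ m) {σ : absoluteGaloisGroup K}
      {v : HeightOneSpectrum (𝓞 K)} (_ : v ∉ S) {𝔓 : Ideal (GaloisRepresentations.absIntegers (𝓞 K) K)}
      (_ : 𝔓 ∈ v.primesAbove) (_ : IsArithFrobAt (𝓞 K) σ 𝔓) {α : Multiset ℂ}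
      (_ : π.HasSatakeParamAt v α),
      (GaloisRepresentations.FramedRep.charpoly (ρ m) (QuotientGroup.mk σ)).roots =
        E₁ v α + (B v).map (· * (((μ (QuotientGroup.mk σ)) ^ m : (PadicAlgCl p)ˣ) :
          PadicAlgCl p)) := by
    intro m hm σ v hv 𝔓 h𝔓 hσ α hα
    rw [hρ_of_le hm, GaloisRepresentations.FramedGaloisRep.charpoly_descend_mk,
      (hRv v hv m.toNat (by omega)).2 α hα 𝔓 h𝔓 σ hσ,
      coe_muS_mk_zpow_of_isArithFrobAt p S hSp hv h𝔓 hσ (by omega),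
      arithFrobPolyOfSatake_eq_prod_roots, multiset_prod_X_sub_C_map (B v),
      ← Multiset.prod_add, ← Multiset.map_add, roots_multiset_prod_X_sub_C]
  -- chosen Frobenius representatives for the elements of `𝔉`
  have hwit : ∀ f ∈ 𝔉, ∃ (σ : absoluteGaloisGroup K) (v : HeightOneSpectrum (𝓞 K))
      (𝔓 : Ideal (GaloisRepresentations.absIntegers (𝓞 K) K)) (α : Multiset ℂ), QuotientGroup.mk σ = f ∧ v ∉ S ∧
        𝔓 ∈ v.primesAbove ∧ IsArithFrobAt (𝓞 K) σ 𝔓 ∧ π.HasSatakeParamAt v α := by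
    rintro _ ⟨σ, ⟨v, hv, 𝔓, h𝔓, hσ⟩, rfl⟩
    obtain ⟨α, hα⟩ := hSat v hv
    exact ⟨σ, v, 𝔓, α, rfl, hv, h𝔓, hσ, hα⟩
  haveI : Nonempty (HeightOneSpectrum (𝓞 K)) := by
    obtain ⟨𝔪, h𝔪⟩ := Ideal.exists_maximal (𝓞 K)
    exact ⟨⟨𝔪, h𝔪.isPrime,
      Ring.ne_bot_of_isMaximal_of_not_isField h𝔪 (RingOfIntegers.not_isField K)⟩⟩
  choose! wσ wv w𝔓 wα hwmk hwS hw𝔓 hwσ hwα using hwit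
  let 𝔈₁ : GammaS K S → Multiset (PadicAlgCl p) := fun f ↦ E₁ (wv f) (wα f)
  let 𝔈₂ : GammaS K S → Multiset (PadicAlgCl p) := fun f ↦ B (wv f)
  have h𝔈 : ∀ f ∈ 𝔉, Multiset.card (𝔈₁ f) = n ∧ Multiset.card (𝔈₂ f) = n ∧
      (0 : PadicAlgCl p) ∉ 𝔈₁ f ∧ (0 : PadicAlgCl p) ∉ 𝔈₂ f := by
    intro f hf
    refine ⟨?_, (hB (wv f) (hwS f hf)).1, ?_, (hB (wv f) (hwS f hf)).2⟩
    · change Multiset.card (E₁ (wv f) (wα f)) = n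
      rw [card_roots_arithFrobPolyOfSatake, (hwα f hf).card_eq]
    · change (0 : PadicAlgCl p) ∉ E₁ (wv f) (wα f)
      exact zero_not_mem_roots_arithFrobPolyOfSatake ι
        (lt_trans zero_lt_one (wv f).one_lt_residueCard) n (hne (hwα f hf))
  -- the infinite set of exponents `ℳ = [N₀, ∞)`
  let ℳ : Set ℤ := Set.Ici (N₀ : ℤ)
  have hℳ : ℳ.Infinite := Set.Ici_infinite _
  have hss : ∀ m ∈ ℳ, (ρ m).toContinuousRep.IsSemisimple := by
    intro m hm
    have hm' : (N₀ : ℤ) ≤ m := hm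
    rw [hρ_of_le hm', ← GaloisRepresentations.FramedRep.isSemisimple_inflate_iff, GaloisRepresentations.FramedGaloisRep.inflate_descend]
    exact hRss _ (by omega)
  have hρ : ∀ m ∈ ℳ, ∀ f ∈ 𝔉, (GaloisRepresentations.FramedRep.charpoly (ρ m) f).roots =
      𝔈₁ f + (𝔈₂ f).map (· * (((μ f) ^ m : (PadicAlgCl p)ˣ) : PadicAlgCl p)) := by
    intro m hm f hf
    have hm' : (N₀ : ℤ) ≤ m := hm
    have key := hcomp hm' (hwS f hf) (hw𝔓 f hf) (hwσ f hf) (hwα f hf)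
    rw [hwmk f hf] at key
    exact key
  -- Prop. 7.12
  obtain ⟨ρ₁, hρ₁ss, hρ₁⟩ := h712.exists_fst h𝔉 hn μ hμord 𝔈₁ 𝔈₂ h𝔈 hℳ ρ hss hρ
  -- `r := ρ¹ ∘ (Γ_K → Γ_{K,S})`
  refine ⟨ρ₁.inflate, (GaloisRepresentations.FramedRep.isSemisimple_inflate_iff ρ₁).mpr hρ₁ss, ?_⟩
  intro v hv
  refine ⟨ρ₁.inflate_isUnramifiedAt hv, ?_⟩
  intro α hα 𝔓 h𝔓 σ hσ
  have hf : (QuotientGroup.mk σ : GammaS K S) ∈ 𝔉 := ⟨σ, ⟨v, hv, 𝔓, h𝔓, hσ⟩, rfl⟩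
  -- `𝔈¹_{Frob} = E₁ v α`: independence of the chosen representative (Cor. 7.3)
  have hE : 𝔈₁ (QuotientGroup.mk σ) = E₁ v α := by
    set f : GammaS K S := QuotientGroup.mk σ with hf_def
    refine (twistedSum_unique (hμord f hf) hℳ (h𝔈 f hf).2.2.2 (hB v hv).2 fun m hm ↦ ?_).1
    have hm' : (N₀ : ℤ) ≤ m := hm
    rw [← hρ m hm f hf]
    exact hcomp hm' hv h𝔓 hσ hα
  have hmonic : (GaloisRepresentations.FramedRep.charpoly ρ₁ (QuotientGroup.mk σ : GammaS K S)).Monic :=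
    Matrix.charpoly_monic _
  rw [GaloisRepresentations.FramedRep.charpoly_inflate, eq_prod_roots_of_monic hmonic, hρ₁ _ hf, hE]
  exact (arithFrobPolyOfSatake_eq_prod_roots ι _ n α).symm

/-! ### The good places for a predicate on rational primes -/

section GoodPlaces

variable {n : ℕ} {K : Type} [Field K] [NumberField K] {hcpt : isCompact_glFiniteIntegralLevel n K}

/-- **From compatibility data at the places over good rational primes to a Galois
representation.**  Let `Q` be a predicate on rational primes ("good": in the applications,
`q` unramified in `K`, or `q` split in `F₀` or unramified in `K`) such that all but finitely
many places of `K` lie over a prime `q ≠ p` with `Q q` above which `π` is unramified, and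
suppose the data `N₀, R, B` of Cor. 6.27 satisfy its conclusion at every place over such a `q`.
Then there is a continuous semisimple `r : Γ_K → GL_n(ℚ̄_p)` with `IsGaloisCompatibleAt π ı r v`
at every `v | q`, `q ≠ p` prime, `Q q`, `π` unramified above `q` — `theorem713_of_goodPlaces`
with `S` = the places not over a good prime. [cite: HarrisLanTaylorThorneRMS2016, proof of
Thm. 7.13 (p. 232)] -/
theorem exists_isGaloisCompatibleAt_of_goodPrime (h712 : Literature.NumberTheory.GaloisRepresentations.HarrisLanTaylorThorne2016.prop712Hausdorff)
    (hC : Automorphic.chebotarev_artinRep) (hne : hasSatakeParamAt_ne_zero)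
    (p : ℕ) [Fact p.Prime] (hn : 0 < n) (π : AutomorphicRepData (AutomorphyDatum.gl n K hcpt))
    (ι : PadicAlgCl p ≃+* ℂ) (Q : ℕ → Prop)
    (hfin : {v : HeightOneSpectrum (𝓞 K) | ¬ ∃ q : ℕ, q.Prime ∧ q ≠ p ∧ Q q ∧
      π.IsUnramifiedAbove q ∧ ((q : ℕ) : 𝓞 K) ∈ v.asIdeal}.Finite)
    {N₀ : ℕ} {R : ℕ → GaloisRepresentations.FramedGaloisRep K (PadicAlgCl p) (2 * n)}
    {B : HeightOneSpectrum (𝓞 K) → Multiset (PadicAlgCl p)}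
    (hRss : ∀ N, N₀ ≤ N → (R N).toGaloisRep.IsSemisimple)
    (hB : ∀ v, Multiset.card (B v) = n ∧ (0 : PadicAlgCl p) ∉ B v)
    (hR : ∀ q : ℕ, q.Prime → q ≠ p → Q q → π.IsUnramifiedAbove q →
      ∀ v : HeightOneSpectrum (𝓞 K), ((q : ℕ) : 𝓞 K) ∈ v.asIdeal →
      ∀ α : Multiset ℂ, π.HasSatakeParamAt v α → ∀ N, N₀ ≤ N →
        (R N).IsUnramifiedAt v ∧
        (R N).HasFrobCharpolyAt v (arithFrobPolyOfSatake ι v.residueCard n α *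
          ((B v).map fun b ↦ X - C (b * ((v.residueCard : PadicAlgCl p)⁻¹) ^ (2 * N))).prod)) :
    ∃ r : GaloisRepresentations.FramedGaloisRep K (PadicAlgCl p) n, r.toGaloisRep.IsSemisimple ∧
      ∀ q : ℕ, q.Prime → q ≠ p → Q q → π.IsUnramifiedAbove q →
        ∀ v : HeightOneSpectrum (𝓞 K), ((q : ℕ) : 𝓞 K) ∈ v.asIdeal →
          IsGaloisCompatibleAt π ι r v := by
  have hp : p.Prime := Fact.out
  -- the finite set `S` of bad places; good places `v ∉ S`
  set S : Set (HeightOneSpectrum (𝓞 K)) := {v | ¬ ∃ q : ℕ, q.Prime ∧ q ≠ p ∧ Q q ∧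
      π.IsUnramifiedAbove q ∧ ((q : ℕ) : 𝓞 K) ∈ v.asIdeal} with hS_def
  have hgood : ∀ v ∉ S, ∃ q : ℕ, q.Prime ∧ q ≠ p ∧ Q q ∧ π.IsUnramifiedAbove q ∧
      ((q : ℕ) : 𝓞 K) ∈ v.asIdeal := fun v hv ↦ by
    simpa only [hS_def, Set.mem_setOf_eq, not_not] using hv
  have hSp : ∀ v ∉ S, ((p : ℕ) : 𝓞 K) ∉ v.asIdeal := fun v hv ↦ by
    obtain ⟨q, hq, hqp, -, -, hqv⟩ := hgood v hv
    exact natCast_not_mem_of_natCast_mem hq hp hqp hqv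
  have hSat : ∀ v ∉ S, ∃ α : Multiset ℂ, π.HasSatakeParamAt v α := fun v hv ↦ by
    obtain ⟨q, -, -, -, hπq, hqv⟩ := hgood v hv
    exact hπq v hqv
  have hRv : ∀ v ∉ S, ∀ N, N₀ ≤ N → (R N).IsUnramifiedAt v ∧
      ∀ α : Multiset ℂ, π.HasSatakeParamAt v α →
        (R N).HasFrobCharpolyAt v (arithFrobPolyOfSatake ι v.residueCard n α *
          ((B v).map fun b ↦ X - C (b * ((v.residueCard : PadicAlgCl p)⁻¹) ^ (2 * N))).prod) := by
    intro v hv N hN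
    obtain ⟨q, hq, hqp, hQ, hπq, hqv⟩ := hgood v hv
    obtain ⟨α₀, hα₀⟩ := hπq v hqv
    exact ⟨(hR q hq hqp hQ hπq v hqv α₀ hα₀ N hN).1,
      fun α hα ↦ (hR q hq hqp hQ hπq v hqv α hα N hN).2⟩
  obtain ⟨r, hrss, hr⟩ := theorem713_of_goodPlaces h712 hC hne p hn π ι hfin hSp hSat hRss
    (fun v _ ↦ hB v) hRv
  refine ⟨r, hrss, fun q hq hqp hQ hπq v hqv α hα ↦ ?_⟩
  have hv : v ∉ S := by
    rw [hS_def]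
    simp only [Set.mem_setOf_eq, not_not]
    exact ⟨q, hq, hqp, hQ, hπq, hqv⟩
  exact ⟨(hr v hv).1, (hr v hv).2 α hα⟩

/-- The bad places for a predicate `Q` weaker than "unramified in `K`" are finite: they are
among the bad places of `finite_setOf_not_exists_goodPrime` (those over `p`, over a rational
prime ramified in `K`, or over a prime below a ramified place of `π`; `hcof` = Flath).
[folklore] -/
theorem finite_setOf_not_exists_goodPrime_of_imp
    (π : AutomorphicRepData (AutomorphyDatum.gl n K hcpt)) (hcof : π.hasSatakeParamAt_cofinite)
    (p : ℕ) (hp : p.Prime) {Q : ℕ → Prop}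
    (hQ : ∀ q : ℕ, q.Prime → Algebra.IsUnramifiedIn (𝓞 K) (Ideal.span {(q : ℤ)}) → Q q) :
    {v : HeightOneSpectrum (𝓞 K) | ¬ ∃ q : ℕ, q.Prime ∧ q ≠ p ∧ Q q ∧
      π.IsUnramifiedAbove q ∧ ((q : ℕ) : 𝓞 K) ∈ v.asIdeal}.Finite := by
  refine (finite_setOf_not_exists_goodPrime π hcof p hp).subset fun v hv ↦ ?_
  simp only [Set.mem_setOf_eq] at hv ⊢
  rintro ⟨q, hq, hqp, hKq, hπq, hqv⟩
  exact hv ⟨q, hq, hqp, hQ q hq hKq, hπq, hqv⟩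

end GoodPlaces

/-! ### Thm. 7.13 with both alternatives on `q` -/

/-- **Harris–Lan–Taylor–Thorne 2016, Thm. 7.13 (`n > 1`), both printed alternatives on `q` —
PROVED** from the named facts Prop. 7.12 (`prop712Hausdorff`), Cor. 6.27 with both alternatives
(`corollary627_splitOrUnramified`), Chebotarev (`chebotarev_artinRep`, through `frobenius_dense`)
and the non-vanishing of Satake parameters (`hasSatakeParamAt_ne_zero`), for `π` unramified
almost everywhere (`hcof`, Flath).  Let `K` be a CM field, `F₀ ⊆ K` an imaginary quadratic
subfield in which the prime `p` splits (HLTT's `F = F₀F⁺`, p. 11), `n > 1`, `π` a cuspidal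
automorphic representation of `GL_n(𝔸_K)` with `π_∞` regular algebraic, `ı : ℚ̄_p ≃ ℂ`.  Then
there is a continuous semisimple `r : Γ_K → GL_n(ℚ̄_p)` such that for every rational prime
`q ≠ p` which **either splits in `F₀` or is unramified in `K`**, above which `π` is unramified,
and every `v | q`: `r` is unramified at `v` and every arithmetic Frobenius at `v` has
characteristic polynomial `arithFrobPolyOfSatake ı q_v n α` for the Satake parameter `α` of `π_v`
(`IsGaloisCompatibleAt`, the tree's form of `r|^{F-ss}_{W_{K_v}} = ı⁻¹ rec(π_v |det|^{(1-n)/2})`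
for unramified `π_v`, review 13).  This is the printed Thm. 7.13 (p. 232) except for the case
`n = 1` ("well known"), which is not treated.  Proof: `exists_isGaloisCompatibleAt_of_goodPrime`
(the printed Prop. 7.12 argument, `theorem713_of_goodPlaces`) with the good primes
`q ≠ p`, (`q` split in `F₀` or unramified in `K`), `π` unramified above `q`, whose complement is
finite (`finite_setOf_not_exists_goodPrime_of_imp`).
[cite: HarrisLanTaylorThorneRMS2016, Thm. 7.13 and its proof (p. 232)] -/
theorem theorem713_of (h712 : Literature.NumberTheory.GaloisRepresentations.HarrisLanTaylorThorne2016.prop712Hausdorff)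
    (h627 : corollary627_splitOrUnramified) (hC : Automorphic.chebotarev_artinRep)
    (hne : hasSatakeParamAt_ne_zero)
    {n : ℕ} {K : Type} [Field K] [NumberField K] (hcpt : isCompact_glFiniteIntegralLevel n K)
    (p : ℕ) [Fact p.Prime] (hn : 1 < n) (hCM : IsCMField K)
    (F₀ : IntermediateField ℚ K) (hF₀ : Module.finrank ℚ F₀ = 2 ∧ IsTotallyComplex F₀)
    (hF₀p : HasTwoPrimesOver F₀ p)
    (π : CuspidalAutomorphicRepData n K hcpt) (hπ : π.1.IsRegularAlgebraic)
    (hcof : π.1.hasSatakeParamAt_cofinite) (ι : PadicAlgCl p ≃+* ℂ) :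
    ∃ r : GaloisRepresentations.FramedGaloisRep K (PadicAlgCl p) n, r.toGaloisRep.IsSemisimple ∧
      ∀ q : ℕ, q.Prime → q ≠ p →
        (HasTwoPrimesOver F₀ q ∨ Algebra.IsUnramifiedIn (𝓞 K) (Ideal.span {(q : ℤ)})) →
        π.1.IsUnramifiedAbove q →
        ∀ v : HeightOneSpectrum (𝓞 K), ((q : ℕ) : 𝓞 K) ∈ v.asIdeal →
          IsGaloisCompatibleAt π.1 ι r v := by
  obtain ⟨N₀, R, B, hRss, hB, hR⟩ := h627 hcpt p hn hCM F₀ hF₀ hF₀p π hπ ι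
  exact exists_isGaloisCompatibleAt_of_goodPrime h712 hC hne p (lt_trans zero_lt_one hn) π.1 ι
    (fun q ↦ HasTwoPrimesOver F₀ q ∨ Algebra.IsUnramifiedIn (𝓞 K) (Ideal.span {(q : ℤ)}))
    (finite_setOf_not_exists_goodPrime_of_imp π.1 hcof p Fact.out fun _ _ h ↦ Or.inr h)
    hRss hB hR

/-- The two-alternative Thm. 7.13 specialises to the statement of `theorem713_unramified_of`
(the branch "`q` unramified in `K`"), now from `corollary627_splitOrUnramified`. [folklore] -/
theorem theorem713_unramified_of_splitOrUnramified (h712 : Literature.NumberTheory.GaloisRepresentations.HarrisLanTaylorThorne2016.prop712Hausdorff)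
    (h627 : corollary627_splitOrUnramified) (hC : Automorphic.chebotarev_artinRep)
    (hne : hasSatakeParamAt_ne_zero)
    {n : ℕ} {K : Type} [Field K] [NumberField K] (hcpt : isCompact_glFiniteIntegralLevel n K)
    (p : ℕ) [Fact p.Prime] (hn : 1 < n) (hCM : IsCMField K)
    (hF₀ : HasSplitImaginaryQuadraticSubfield K p)
    (π : CuspidalAutomorphicRepData n K hcpt) (hπ : π.1.IsRegularAlgebraic)
    (hcof : π.1.hasSatakeParamAt_cofinite) (ι : PadicAlgCl p ≃+* ℂ) :
    ∃ r : GaloisRepresentations.FramedGaloisRep K (PadicAlgCl p) n, r.toGaloisRep.IsSemisimple ∧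
      ∀ q : ℕ, q.Prime → q ≠ p → Algebra.IsUnramifiedIn (𝓞 K) (Ideal.span {(q : ℤ)}) →
        π.1.IsUnramifiedAbove q →
        ∀ v : HeightOneSpectrum (𝓞 K), ((q : ℕ) : 𝓞 K) ∈ v.asIdeal →
          IsGaloisCompatibleAt π.1 ι r v := by
  obtain ⟨F₀, hF₀, hF₀p⟩ := hF₀
  obtain ⟨r, hrss, hr⟩ := theorem713_of h712 h627 hC hne hcpt p hn hCM F₀ hF₀ hF₀p π hπ hcof ι
  exact ⟨r, hrss, fun q hq hqp hKq ↦ hr q hq hqp (Or.inr hKq)⟩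

end Literature.NumberTheory.Automorphic.HarrisLanTaylorThorne2016
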